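import Summits.Langlands.Langlands.Theses.ParahoricFibre
import HarnessLib

/-!
# Birth skeleton (BC3) for the crux `ParahoricOccurrence` (item stmt-Langlands-18194) of route
`ParahoricFibre` — published as `Cruxes/ParahoricOccurrence/Lines/birth.lean`
(skeleton registrar `planner-skel-stmt-Langlands-18194-0`, 2026-08-17; route re-audit bin HONEST).

**The crux** (route decl `Summit.Langlands.Langlands.Theses.ParahoricFibre.ParahoricOccurrence`,
28 binders): PARAHORIC OCCURRENCE at a Taylor place in the patching range — `K` CM, `π` regular
algebraic cuspidal on `GL_n(𝔸_K)`, `p > n²`, `p ∤ disc K`, `π` unramified above `p`, `ρ` semisimple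
and Satake–Frobenius compatible with `(π, ι)` a.e., with an integral model `gρg⁻¹` whose reduction
contains `SL_n(𝔽_p)` and a decomposed generic prime `l`; `v ∤ p` with `q_v ≡ 1 (mod p)`,
`gρ|_{Γ_{K_v}}g⁻¹ ≡ 1 (mod 𝔪)`, `ρ(I_v)` unipotent; then for every Grothendieck–Deligne
`W = WD(ρ|_{Γ_{K_v}})` the local component `π_v` has a non-zero vector fixed by the standard
parahoric `𝔭(W)` whose blocks are the DUAL Jordan partition of `N = W.N`
(`blk_W(i) = #{t : n ≤ i + rk N^{t+1}}`; `N = 0` gives `GL_n(𝒪_v)`, `N` regular gives `Iw_v`;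
Matsumoto's condition (3) of Prop. 2.15, arXiv:2312.01551 p. 17, with Def. 2.4 / Lemma 2.6 p. 15).

**The split = the route's lever read in the currency patching actually produces** (spaces of
automorphic forms of level `U^v · 𝔭(W)`, i.e. GLOBAL vectors of `π = W/W'` fixed modulo `W'` by
`ι_v(𝔭(W))`), with the two KNOWN ends of the argument isolated as their own stubs:

* `stub_iwahoriOccurrence` — IWAHORI OCCURRENCE (known in print, open in Lean): under the
  crux-type data (`K` CM, `π` RA cuspidal, `ρ` semisimple Satake-compatible, `v ∤ p`,
  `ρ(I_v)` unipotent) the global `π = W/W'` has a vector fixed mod `W'` by `ι_v(Iw_v)`.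
  Mechanism: `ρ ≅ r_ι(π)^{ss}` (Chebotarev + Brauer–Nesbitt, in tree
  `FramedGaloisRep.nonempty_equiv_of_hasFrobCharpolyAt_eventually` once HLTT's `r` exists);
  Varma's semisimple local–global compatibility `WD(r_ι(π)|_v)^{ss} ≅ rec(π_v|det|^{(1-n)/2})^{ss}`
  (VarmaFMS2024 Thm. 1; Matsumoto arXiv:2312.01551 Thm. 2.18), so the supercuspidal support of
  `π_v` consists of unramified characters; Borel's theorem (Borel1976, Thm. 4.10 / Lemma 4.7:
  every irreducible constituent of an unramified principal series has `Iw`-fixed vectors);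
  Flath's `⊗'` (global vector `x ⊗ y` lifted to `W`).  It is the INPUT of the lever: it puts
  the eigensystem of `π` on the Iwahori-level Hecke algebra / in the support of the Iwahori
  patched module.
* `stub_parahoricPatchingDatum` — THE LEVER (open; the route's `IwahoriDatum`, typed
  self-containedly): all crux hypotheses + Iwahori occurrence ⇒ there are a Noetherian ring `R`
  (intended `R_∞`), a finite `R`-module `M` (intended: the `𝔭(W)`-level patched module
  `e_{𝔭(W)} M_∞^{Iw} = M_∞^{𝔭(W)}` of Calegari–Geraghty/ACC+ patching with Taylor's Ihara-avoidance
  local condition at `v`), primes `𝔮 ≤ 𝔭x` of `R` (intended: `𝔮` = generic point of the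
  irreducible component of `Spec R_∞` of monodromy type `μ(W)` at `v` through the classical
  point, `𝔭x` = the classical point `x = (ρ, π)`), with
  (GENERIC SUPPORT) `M_𝔮 ≠ 0` — nearly-faithfulness of the Iwahori patched module on every
  component of the unipotent lifting ring (Taylor2008 Lemma 2.3 + Ihara avoidance; ACC+ §6.5)
  descended from `Iw` to `𝔭(W)` at the generic point by the Hecke-generic argument (centre of
  `H(GL_n(K_v)//Iw)` acts through the universal Frobenius; Borel–Casselman; Matsumoto Lemma 2.6:
  an irreducible Iwahori-spherical representation whose parameter admits only nilpotents of type
  `≤ μ` has `𝔭(μ)`-invariants) — and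
  (CLASSICAL FIBRE) `M_{𝔭x} ≠ 0 →` global `𝔭(W)`-occurrence — the fibre of `M_∞^{𝔭(W)}[1/p]` at
  `x` is the `λ_π`-eigenspace of `S_{U^v𝔭(W)}(U, E)_𝔪`, non-zero iff `π` has `U^v𝔭(W)`-fixed
  vectors (top-degree/`Tor` bookkeeping in positive defect = the crux's "why it might fail").
  Nearest prior art for the generic-support clause: Shotton2018 (arXiv:1608.01784, Thm. 4.6,
  Lemma 5.18, Cor. "patch = cycle": in a definite-unitary setting the support of the
  `GL_n(𝒪_F)`-type patched module `H_∞(σ)` is the cycle `cyc(σ)`, PROVED there from known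
  local–global compatibility; the route runs this backwards over CM fields where `N` is unknown).
* `stub_localComponentOfParahoricFixed` — FLATH LOCALISATION at parahoric level (known in
  print, open in Lean; Borel–Jacquet model, arbitrary block labelling `b : Fin n → ℕ`): a global
  vector of `π = W/W'` fixed mod `W'` by `ι_v(P_b)` gives an irreducible smooth local component
  `π_v` (`HasLocalComponentAt`) with a non-zero `P_b`-fixed vector (`W/W'|_{GL_n(K_v)}` is
  `π_v`-isotypic, FlathCorvallis1979 Thm. 3–4 = Bump1997 Thm. 3.3.3; `P_b` compact open, so
  `P_b`-invariants is exact on smooth `ℂ`-representations).  The tree has the SPHERICAL analogue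
  in the `L²` model (`CuspidalAutomorphicRepGL.exists_hasLocalComponentAt_of_mem_fixedVectors_sphericalLevelAt`),
  not this one.
* `ParahoricOccurrence_of` — the composition, kernel-checked, no `sorry`: Iwahori occurrence
  feeds the datum; SUPPORT IS CLOSED UNDER SPECIALISATION (`Module.mem_support_mono`, proved
  here as `nontrivial_localizedModule_of_le`) moves `M_𝔮 ≠ 0` to `M_{𝔭x} ≠ 0`; the classical
  fibre gives global `𝔭(W)`-occurrence; Flath localisation gives the crux BY NAME.

**Currency pitfall recorded (why the fibre clause is in SUPPORT currency).** The informal lever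
says "support of a finite module is specialisation-closed, hence the fibre at `x` is non-zero".
Typed as `M/𝔭x M ≠ 0` this is VACUOUS over a local `R_∞` (Nakayama: `M/𝔭M ≠ 0` for EVERY prime
once `M ≠ 0`) and would let torsion congruences (`M₀ = 𝒪` with a congruent eigensystem
`λ' ≡ λ_π mod p^k`, where `M₀/𝔭x M₀ = 𝒪/p^k ≠ 0` although `λ_π` does not occur in `M₀[1/p]`)
masquerade as occurrence.  The honest clause is `𝔭x ∈ Supp_R M`, i.e. `M_{𝔭x} ≠ 0`
(localisation at the characteristic-`0` point inverts `p`), and then the algebra step is exactly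
`Module.mem_support_mono` — a one-liner, so the route's foreseen "SupportSpecialisation" stub is
PROVED here rather than registered (no bookkeeping stub).

**Honesty note on strength.** Modulo the proved one-liner, `stub_parahoricPatchingDatum` is
logically EQUIVALENT to global `𝔭(W)`-occurrence under the crux hypotheses (a trivial datum
`R = M =` a field, `𝔮 = 𝔭x = 0` witnesses the converse); and global occurrence is the crux up to
Flath (stub 3 and its easy converse).  So the lever stub is crux-strength — necessarily: the
crux is ONE construction, and its two genuinely different KNOWN ingredients (Iwahori occurrence,
Flath localisation) are what can be split off over accepted declarations.  The `∃ (R, M, 𝔮, 𝔭x)`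
shape is kept, not as a claimed weakening, but because its two clauses ARE the prover's
obligations (generic support on `𝒞_{μ(W)}`; classical fibre) in the form the patching argument
delivers them; the Hecke-generic descent cannot be a separate typed stub until an
`IwahoriHeckeAlgebra (GL (Fin n) K_v)` with its centre exists in the tree (definition request
already recorded in the route header).  BC3 probes (registrar's folder `bc/ParahoricOccurrence_probe*.lean`):
for each stub `P`, `P → ParahoricOccurrence` and `P → Langlands` by
`first | exact? | simpa [P] | (unfold P; simpa) | aesop` FAIL (6/6 at 400000 heartbeats;
per tactic at 2000000: `exact?` "could not close the goal" 12/12, `aesop` "failed after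
exhaustive search" 6/6).

Disproof used: none exists for this crux (`ledger crux ls stmt-Langlands-18194`: no
`Disproof.lean`, no `Negative/` lemmas before this file).  Negatives index of the summit
(4 entries: SplitPrimeInduction ×2, OrdinaryPrimeTransport, K3KugaSatakeDescent) — no stub is an
instance of any of them.  Dead lines: none recorded on this crux.  The opening planner's birth
evidence (`ParahoricOccurrence_birth.lean`, stubs `SupportSpecialisationStatement` +
`IwahoriDatumStatement`) is not readable from a compute-free seat (evidence store not mounted);
this file re-derives the skeleton from the route text and sharpens it as above.
-/

noncomputable section

set_option linter.dupNamespace false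

namespace Summit.Langlands.Langlands.Cruxes.ParahoricOccurrence.Birth

open scoped Matrix NumberField Classical -- `Classical`: the place subtypes indexing `mixedSpace K` are `Fintype` classically (`NormedCommRing (mixedSpace K)`), as in the route file
open IsDedekindDomain NumberField Polynomial Filter
open Literature.NumberTheory.Automorphic Literature.NumberTheory.GaloisRepresentations
open Summit.Langlands

/-! ### Stub 1 — Iwahori occurrence at a place of unipotent inertia (known in print) -/

/-- **stub 1 — IWAHORI OCCURRENCE.**  For `K` CM, `π` regular algebraic cuspidal on `GL_n(𝔸_K)`,
`ρ : Γ_K → GL_n(ℚ̄_p)` semisimple and Satake–Frobenius compatible with `(π, ι)` at cofinitely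
many places, and a finite `v ∤ p` at which `ρ(I_v)` is unipotent (`(ρ(σ) - 1)^n = 0` on
`absInertia`), the global representation `π = W/W'` has a vector `φ ∈ W ∖ W'` fixed MODULO `W'`
by the Iwahori subgroup at `v`: `R(ι_v g) φ - φ ∈ W'` for every `g ∈ GL_n(K_v)` that is
integral with unit determinant and has sub-diagonal entries (`j < i`) in `𝔭_v` (the standard
Iwahori, block labelling `id`; spelled with `Valued.v` exactly as the crux spells `𝔭(W)`).
Why plausibly true: `ρ ≅ r_ι(π)^{ss}`; Varma's semisimple compatibility makes `rec(π_v)^{ss}`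
unramified, so `π_v` lies in the Iwahori block and `π_v^{Iw} ≠ 0` (Borel 1976); Flath lifts a
local `Iw`-fixed vector to a global one mod `W'`.  Size: L in Lean (needs `r_ι(π)` + Varma as
facts).  Leans on: `CuspidalAutomorphicRepData`, `FramedGaloisRep`, `arithFrobPolyOfSatake`,
`absInertia`, `rightTranslation`, `GLn.ofLocal` (accepted).
[cite: VarmaFMS2024, Thm. 1] [cite: Borel1976, Lemma 4.7 and Thm. 4.10]
[cite: Matsumoto2023LGC, Thm. 2.18] [cite: FlathCorvallis1979, Thm. 3 and Thm. 4] -/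
theorem stub_iwahoriOccurrence : ∀ (K : Type) [Field K] [NumberField K], NumberField.IsCMField K → ∀ (n : ℕ) (hcpt : isCompact_glFiniteIntegralLevel n K) (π : CuspidalAutomorphicRepData n K hcpt), π.1.IsRegularAlgebraic → ∀ (p : ℕ) [Fact p.Prime] (ι : PadicAlgCl p ≃+* ℂ) (ρ : FramedGaloisRep K (PadicAlgCl p) n), ρ.toGaloisRep.IsSemisimple → (∀ᶠ v : HeightOneSpectrum (𝓞 K) in cofinite, ∀ α : Multiset ℂ, π.1.HasSatakeParamAt v α → ρ.IsUnramifiedAt v ∧ ρ.HasFrobCharpolyAt v (arithFrobPolyOfSatake ι v.residueCard n α)) → ∀ v : HeightOneSpectrum (𝓞 K), ((p : ℕ) : 𝓞 K) ∉ v.asIdeal → (∀ σ ∈ absInertia (v.adicCompletion K), (((ρ.toLocal v σ : GL (Fin n) (PadicAlgCl p)) : Matrix (Fin n) (Fin n) (PadicAlgCl p)) - 1) ^ n = 0) → ∃ φ ∈ π.1.W, φ ∉ π.1.W' ∧ ∀ g₁ : GL (Fin n) (v.adicCompletion K), (∀ i j : Fin n, Valued.v ((g₁ : Matrix (Fin n)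 (Fin n) (v.adicCompletion K)) i j) ≤ 1) → Valued.v (g₁ : Matrix (Fin n) (Fin n) (v.adicCompletion K)).det = 1 → (∀ i j : Fin n, j < i → Valued.v ((g₁ : Matrix (Fin n) (Fin n) (v.adicCompletion K)) i j) < 1) → rightTranslation (AdelicGroupData.gl n K) (GLn.ofLocal n K v g₁) φ - φ ∈ π.1.W' := by
  sorry

/-! ### Stub 2 — the parahoric patching datum (the lever; open) -/

/-- **stub 2 — THE `𝔭(W)`-LEVEL PATCHING DATUM** (the route's `IwahoriDatum`, self-contained
typing).  Under ALL the crux hypotheses (patching range: `p > n²`, `p ∤ disc K`, `π` unramified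
above `p`, integral model with residual image `⊇ SL_n(𝔽_p)`, decomposed generic prime; Taylor
normal form at `v`: `q_v ≡ 1 (p)`, residually trivial, unipotent inertia; `W = WD(ρ|_{Γ_{K_v}})`)
and given IWAHORI OCCURRENCE of `π` at `v` (stub 1's conclusion, consumed here: it places the
eigensystem of `π` in the support of the Iwahori-level patched module), there exist a
commutative Noetherian ring `R`, a finite `R`-module `M` and primes `𝔮 ≤ 𝔭x` of `R` with
* GENERIC SUPPORT `Nontrivial (LocalizedModule 𝔮.primeCompl M)` (`M_𝔮 ≠ 0`), and
* CLASSICAL FIBRE `Nontrivial (LocalizedModule 𝔭x.primeCompl M) →` `π = W/W'` has a vector fixed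
  mod `W'` by `ι_v(𝔭(W))`, `𝔭(W)` = integral `g₁` with unit determinant and `(i,j)`-entry in
  `𝔭_v` whenever `blk_W(j) < blk_W(i)`, `blk_W(i) = #{t : n ≤ i + rk (W.N)^{t+1}}` (verbatim
  the crux's parahoric).
Intended witness (the lever): `R = R_∞`, `M = M_∞^{𝔭(W)}` (ACC+/Taylor patching at level
`U^v · 𝔭(W)`, Ihara-avoidance condition at `v`), `𝔭x` = the classical point, `𝔮` = generic point
of the component of monodromy type `μ(W)` at `v` through `x`; generic support = nearly faithful
Iwahori patched module (Taylor 2008 Lemma 2.3, ACC+ §6.5) + Hecke-generic descent `Iw ⇝ 𝔭(W)`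
at `𝔮` (centre of the Iwahori–Hecke algebra ≡ universal Frobenius; Borel–Casselman; Matsumoto
Lemma 2.6); classical fibre = `M_∞^{𝔭(W)}[1/p]` at `x` is the `λ_π`-part of
`S_{U^v𝔭(W)}(U,E)_𝔪`.  Why it might fail: exactly the crux's — in defect `l₀ > 0` the
`H_{Iw}`-action on patched TOP-degree cohomology must commute with `𝕋_∞` well enough that the
classical fibre is `(π_v^{Iw})^c` and the centre acts via Frobenius at non-classical generic
points.  HONESTY: modulo `Module.mem_support_mono` this statement is equivalent to global
`𝔭(W)`-occurrence (trivial datum for the converse) — crux-strength by necessity, see the module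
docstring; its two clauses are the prover's actual obligations.  Size: open problem (the route's
rank-2 crux).  Nearest prior art: Shotton's patching functor `σ ↦ H_∞(σ)` with
`Z(H_∞(σ)) = c · cyc(σ)` in the self-dual setting.
[cite: Taylor2008, Lemma 2.3] [cite: AllenCalegariCaraianiGeeEtAl2023, §6.5]
[cite: Matsumoto2023LGC, Lemma 2.6 and Prop. 2.15] [cite: Shotton2018, Thm. 4.6 and Lemma 5.18]
[cite: KisinModuli2009, Lemma (3.3.4)] -/
theorem stub_parahoricPatchingDatum : ∀ (K : Type) [Field K] [NumberField K], NumberField.IsCMField K → ∀ (n : ℕ) (hcpt : isCompact_glFiniteIntegralLevel n K) (π : CuspidalAutomorphicRepData n K hcpt), π.1.IsRegularAlgebraic → ∀ (p : ℕ) [Fact p.Prime] (ι : PadicAlgCl p ≃+* ℂ) (ρ : FramedGaloisRep K (PadicAlgCl p) n), ρ.toGaloisRep.IsSemisimple → (∀ᶠ v : HeightOneSpectrum (𝓞 K) in cofinite, ∀ α : Multiset ℂ, π.1.HasSatakeParamAt v α → ρ.IsUnramifiedAt v ∧ ρ.HasFrobCharpolyAt v (arithFrobPolyOfSatake ι v.residueCard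 n α)) → n ^ 2 < p → ¬ ((p : ℤ) ∣ NumberField.discr K) → (∀ w : HeightOneSpectrum (𝓞 K), ((p : ℕ) : 𝓞 K) ∈ w.asIdeal → π.1.IsUnramifiedAt w) → ∀ g : GL (Fin n) (PadicAlgCl p), (∀ (σ : Field.absoluteGaloisGroup K) (i j : Fin n), ‖((g * ρ σ * g⁻¹ : GL (Fin n) (PadicAlgCl p)) : Matrix (Fin n) (Fin n) (PadicAlgCl p)) i j‖ ≤ 1) → (∀ M : Matrix (Fin n) (Fin n) ℤ, M.det = 1 → ∃ σ : Field.absoluteGaloisGroup K, ∀ i j : Fin n, ‖((g * ρ σ * g⁻¹ : GL (Fin n) (PadicAlgCl p)) : Matrix (Fin n) (Fin n) (PadicAlgCl p)) i j - ((M i j : ℤ) : PadicAlgCl p)‖ < 1) → (∃ l : ℕ, l.Prime ∧ l ≠ p ∧ ∀ w : HeightOneSpectrum (𝓞 K), ((l : ℕ) : 𝓞 K) ∈ w.asIdeal → w.residueCard = l ∧ ρ.IsUnramifiedAt w ∧ ∃ a : Fin n → PadicAlgCl p, ρ.HasFrobCharpolyAt w (∏ i, (X - C (a i))) ∧ ∀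 i j : Fin n, i ≠ j → ‖a i - a j‖ = 1 ∧ ‖a i - (l : PadicAlgCl p) * a j‖ = 1) → ∀ v : HeightOneSpectrum (𝓞 K), ((p : ℕ) : 𝓞 K) ∉ v.asIdeal → p ∣ (v.residueCard - 1) → (∀ (σ : Field.absoluteGaloisGroup (v.adicCompletion K)) (i j : Fin n), ‖((g * ρ.toLocal v σ * g⁻¹ : GL (Fin n) (PadicAlgCl p)) : Matrix (Fin n) (Fin n) (PadicAlgCl p)) i j - (1 : Matrix (Fin n) (Fin n) (PadicAlgCl p)) i j‖ < 1) → (∀ σ ∈ absInertia (v.adicCompletion K), (((ρ.toLocal v σ : GL (Fin n) (PadicAlgCl p)) : Matrix (Fin n) (Fin n) (PadicAlgCl p)) - 1) ^ n = 0) → ∀ W : WeilDeligneRep (v.adicCompletion K) (PadicAlgCl p) (Fin n → PadicAlgCl p), IsWeilDeligneOfLadic (ρ.toLocal v).toWeilGroupHom W → (∃ φ ∈ π.1.W, φ ∉ π.1.W' ∧ ∀ g₁ : GL (Fin n) (v.adicCompletion K), (∀ i j : Fin n, Valued.v ((g₁ : Matrix (Fin n) (Fin n) (v.adicCompletion K))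 i j) ≤ 1) → Valued.v (g₁ : Matrix (Fin n) (Fin n) (v.adicCompletion K)).det = 1 → (∀ i j : Fin n, j < i → Valued.v ((g₁ : Matrix (Fin n) (Fin n) (v.adicCompletion K)) i j) < 1) → rightTranslation (AdelicGroupData.gl n K) (GLn.ofLocal n K v g₁) φ - φ ∈ π.1.W') → ∃ (R : Type) (_ : CommRing R) (_ : IsNoetherianRing R) (M : Type) (_ : AddCommGroup M) (_ : Module R M) (_ : Module.Finite R M) (𝔮 𝔭x : Ideal R) (_ : 𝔮.IsPrime) (_ : 𝔭x.IsPrime), 𝔮 ≤ 𝔭x ∧ Nontrivial (LocalizedModule 𝔮.primeCompl M) ∧ (Nontrivial (LocalizedModule 𝔭x.primeCompl M) → ∃ φ ∈ π.1.W, φ ∉ π.1.W' ∧ ∀ g₁ : GL (Fin n) (v.adicCompletion K), (∀ i j : Fin n, Valued.v ((g₁ : Matrix (Fin n) (Fin n) (v.adicCompletion K)) i j) ≤ 1) → Valued.v (g₁ : Matrix (Fin n) (Fin n) (v.adicCompletion K)).det = 1 → (∀ i j : Fin n, (Finset.univ.filter fun t : Fin n => n ≤ j.val + Module.finrank (PadicAlgCl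 p) (LinearMap.range (W.N ^ (t.val + 1)))).card < (Finset.univ.filter fun t : Fin n => n ≤ i.val + Module.finrank (PadicAlgCl p) (LinearMap.range (W.N ^ (t.val + 1)))).card → Valued.v ((g₁ : Matrix (Fin n) (Fin n) (v.adicCompletion K)) i j) < 1) → rightTranslation (AdelicGroupData.gl n K) (GLn.ofLocal n K v g₁) φ - φ ∈ π.1.W') := by
  sorry

/-! ### Stub 3 — Flath localisation at parahoric level (known in print) -/

/-- **stub 3 — FLATH LOCALISATION AT PARAHORIC LEVEL** (Borel–Jacquet model).  For a cuspidal
automorphic `π = W/W'` of `GL_n(𝔸_K)`, a finite place `v` and ANY block labelling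
`b : Fin n → ℕ`: if some `φ ∈ W ∖ W'` is fixed modulo `W'` by `ι_v(P_b)` (`P_b` = integral `g₁`
with unit determinant and `(i,j)`-entry in `𝔭_v` whenever `b j < b i`, the standard parahoric of
`b`; cf. the accepted `parahoricGL`/`mem_parahoricGL_iff`), then `π` has an irreducible smooth
local component `π_v` at `v` (accepted `HasLocalComponentAt`, `SmoothIrrep`) with a NON-ZERO
`P_b`-fixed vector.  Why true: `W/W' ≅ π_∞ ⊗ ⊗'_w π_w` (Flath), so `W/W'|_{GL_n(K_v)}` is
`π_v`-isotypic; the image of `φ` is a non-zero `P_b`-fixed vector of an isotypic sum, and since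
`P_b` is compact open the `P_b`-averaging idempotent shows some copy of `π_v` has `π_v^{P_b} ≠ 0`;
a `ℂ`-linear section `W/W' → W` turns `x ↦ x ⊗ y` into the required `HasLocalComponentAt` map.
Size: L in Lean (Flath's factorisation for the Borel–Jacquet datum is the named fact
`exists_hasLocalComponentAt`, not yet a theorem); the spherical `L²`-model analogue IS in tree
(`CuspidalAutomorphicRepGL.exists_hasLocalComponentAt_of_mem_fixedVectors_sphericalLevelAt`).
[cite: FlathCorvallis1979, Thm. 3 and Thm. 4] [cite: Bump1997, Thm. 3.3.3]
[cite: BorelJacquetCorvallis1979, §4.6] -/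
theorem stub_localComponentOfParahoricFixed : ∀ (K : Type) [Field K] [NumberField K] (n : ℕ) (hcpt : isCompact_glFiniteIntegralLevel n K) (π : CuspidalAutomorphicRepData n K hcpt) (v : HeightOneSpectrum (𝓞 K)) (b : Fin n → ℕ), (∃ φ ∈ π.1.W, φ ∉ π.1.W' ∧ ∀ g₁ : GL (Fin n) (v.adicCompletion K), (∀ i j : Fin n, Valued.v ((g₁ : Matrix (Fin n) (Fin n) (v.adicCompletion K)) i j) ≤ 1) → Valued.v (g₁ : Matrix (Fin n) (Fin n) (v.adicCompletion K)).det = 1 → (∀ i j : Fin n, b j < b i → Valued.v ((g₁ : Matrix (Fin n) (Fin n) (v.adicCompletion K)) i j) < 1) → rightTranslation (AdelicGroupData.gl n K) (GLn.ofLocal n K v g₁) φ - φ ∈ π.1.W') → ∃ πv : SmoothIrrep (GL (Fin n) (v.adicCompletion K)), π.1.HasLocalComponentAt v πv.ρ ∧ ∃ x : πv.V, x ≠ 0 ∧ ∀ g₁ : GL (Fin n) (v.adicCompletion K), (∀ i j : Fin n, Valued.v ((g₁ : Matrix (Fin n) (Fin n) (v.adicCompletion K)) i j) ≤ 1) → Valued.v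 (g₁ : Matrix (Fin n) (Fin n) (v.adicCompletion K)).det = 1 → (∀ i j : Fin n, b j < b i → Valued.v ((g₁ : Matrix (Fin n) (Fin n) (v.adicCompletion K)) i j) < 1) → πv.ρ g₁ x = x := by
  sorry

/-! ### Proved helper: support is closed under specialisation -/

/-- **Support is closed under specialisation**: if `M_𝔮 ≠ 0` and `𝔮 ≤ 𝔭` then `M_𝔭 ≠ 0` — Mathlib's
`Module.mem_support_mono` read on `LocalizedModule`s.  This is the whole of the route's
foreseen "SupportSpecialisation" step once the classical fibre is (correctly) stated in support
currency; proved, not a stub. [folklore] -/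
theorem nontrivial_localizedModule_of_le {R : Type*} [CommRing R] {M : Type*} [AddCommGroup M]
    [Module R M] {𝔮 𝔭 : Ideal R} [𝔮.IsPrime] [𝔭.IsPrime] (hle : 𝔮 ≤ 𝔭)
    (h : Nontrivial (LocalizedModule 𝔮.primeCompl M)) :
    Nontrivial (LocalizedModule 𝔭.primeCompl M) := by
  have h𝔮 : (⟨𝔮, inferInstance⟩ : PrimeSpectrum R) ∈ Module.support R M := h
  have h𝔭 : (⟨𝔭, inferInstance⟩ : PrimeSpectrum R) ∈ Module.support R M :=
    Module.mem_support_mono (show (⟨𝔮, inferInstance⟩ : PrimeSpectrum R) ≤ ⟨𝔭, inferInstance⟩ from hle) h𝔮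
  exact h𝔭

/-! ### The stub statements as named propositions (the composition's hypotheses, by name)

`_Goal` is internal on purpose: audits listing the file's declarations by short name find the `stub_*`
THEOREMS, while the skeleton check accepts the hypotheses of `ParahoricOccurrence_of` by the stub
names they carry.  Each `_Goal.stub_x` is `type_of% @stub_x` — no text duplicated, no `sorry` inherited. -/

namespace _Goal

/-- The statement of `stub_iwahoriOccurrence`, as a named `Prop` (literally its type). [folklore] -/
def stub_iwahoriOccurrence : Prop :=
  type_of% @Summit.Langlands.Langlands.Cruxes.ParahoricOccurrence.Birth.stub_iwahoriOccurrence

/-- The statement of `stub_parahoricPatchingDatum`, as a named `Prop` (literally its type). [folklore] -/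
def stub_parahoricPatchingDatum : Prop :=
  type_of% @Summit.Langlands.Langlands.Cruxes.ParahoricOccurrence.Birth.stub_parahoricPatchingDatum

/-- The statement of `stub_localComponentOfParahoricFixed`, as a named `Prop` (literally its type). [folklore] -/
def stub_localComponentOfParahoricFixed : Prop :=
  type_of% @Summit.Langlands.Langlands.Cruxes.ParahoricOccurrence.Birth.stub_localComponentOfParahoricFixed

end _Goal

/-! ### The composition (kernel-checked, no `sorry`; concludes the route decl BY NAME) -/

/-- **`ParahoricOccurrence` from its three stubs.**  Under the crux's 28 binders: stub 1 gives
Iwahori occurrence of `π` at `v`; stub 2 then gives the `𝔭(W)`-level datum `(R, M, 𝔮 ≤ 𝔭x)`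
with `M_𝔮 ≠ 0`; support is closed under specialisation (`nontrivial_localizedModule_of_le`), so
`M_{𝔭x} ≠ 0`; the classical-fibre clause yields a global vector fixed mod `W'` by `ι_v(𝔭(W))`;
stub 3 (with `b := blk_W`, solved by unification) localises it to a local component `π_v` with
`π_v^{𝔭(W)} ≠ 0` — literally the crux's conclusion.  Hypotheses are, by name, the statements of
the three stubs; the conclusion is the route decl
`Summit.Langlands.Langlands.Theses.ParahoricFibre.ParahoricOccurrence`.
[cite: Matsumoto2023LGC, Prop. 2.15] [cite: Taylor2008, Lemma 2.3] -/
theorem ParahoricOccurrence_of (h₁ : _Goal.stub_iwahoriOccurrence)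
    (h₂ : _Goal.stub_parahoricPatchingDatum) (h₃ : _Goal.stub_localComponentOfParahoricFixed) :
    Summit.Langlands.Langlands.Theses.ParahoricFibre.ParahoricOccurrence := by
  unfold _Goal.stub_iwahoriOccurrence at h₁
  unfold _Goal.stub_parahoricPatchingDatum at h₂
  unfold _Goal.stub_localComponentOfParahoricFixed at h₃
  intro K _ _ hK n hcpt π hreg p _ ι ρ hss hsat hp hdisc hunr g hint hbig hl v hv hq htriv hunip W hW
  -- Iwahori occurrence (stub 1), the input of the lever
  have hIw := h₁ K hK n hcpt π hreg p ι ρ hss hsat v hv hunip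
  -- the 𝔭(W)-level patching datum (stub 2)
  obtain ⟨R, _, _, M, _, _, _, 𝔮, 𝔭x, _, _, hle, hgen, hfib⟩ :=
    h₂ K hK n hcpt π hreg p ι ρ hss hsat hp hdisc hunr g hint hbig hl v hv hq htriv hunip W hW hIw
  -- support is closed under specialisation: M_𝔮 ≠ 0 and 𝔮 ≤ 𝔭x give M_𝔭x ≠ 0
  have hx : Nontrivial (LocalizedModule 𝔭x.primeCompl M) := nontrivial_localizedModule_of_le hle hgen
  -- classical fibre, then Flath localisation (stub 3) at the block labelling blk_W
  exact h₃ K n hcpt π v _ (hfib hx)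

/-- By-name sanity check: the stubs' own types feed `ParahoricOccurrence_of` and the conclusion is
literally the route decl. -/
example : Summit.Langlands.Langlands.Theses.ParahoricFibre.ParahoricOccurrence :=
  ParahoricOccurrence_of stub_iwahoriOccurrence stub_parahoricPatchingDatum
    stub_localComponentOfParahoricFixed

end Summit.Langlands.Langlands.Cruxes.ParahoricOccurrence.Birth

end
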